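import Mathlib
import Summits.PneNP.PneNP.Statement
import Summits.PneNP.PneNP.Theorems.SoloBlindAnchor
import Literature.Computability.Complexity.TimeHierarchyAE
import Literature.Computability.Complexity.PHCollapseNP
import Literature.Computability.Complexity.ResourceBoundedMeasureFacts
import Literature.Computability.Complexity.ExpTimeMaps
import Literature.Computability.Complexity.ExpTimeCollapses
import HarnessLib

/-!
# Solo (blind) — no diagonal entry into uniform magnification: `E ⊆ PH → PneNP`

Calibration lemma for §B11 of the accompanying document ("uniform hardness magnification:
which sparse languages qualify").  The uniform magnification theorem of McKay–Murray–Williams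
(STOC 2019, Thm. 1.3; tree THEOREMS A–C, `SoloBlindTimeConstructible`) and its abstract form
(THEOREM G of the document: every language presented by seeds of length `s(N)` whose validity
predicate lies in `PH` and whose bit map lies in `FP^{PH}` — measured in the succinct length
`s(N) + log N` — is, under `NP ⊆ P`, decidable by a uniform one-pass streaming algorithm with
`poly(s(N))` space and update time) need the YES-instances to be SUCCINCTLY CERTIFIABLE INSIDE `PH`.
The only sparse languages with PROVED lower bounds of the required strength are diagonal ones
(time-hierarchy / "no complementary speedup" languages, Chen–Jin–Williams FOCS 2019, Thm. 1.5 and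
App. A–B), and the validity predicate of a diagonal language is hard for `E` in the succinct
length.  This file records, in the tree's classes, why that door is closed: the hypothesis that
would place such a predicate in `PH` already proves the summit.

* `SoloBlind.E_not_subset_P : ¬ E ⊆ P` — the almost-everywhere time hierarchy inside `E`
  (`exists_ae_hard_mem_E`, Literature) against `P ⊆ DTIME(2ⁿ)`;
* `SoloBlind.PH_eq_P_of_P_eq_NP : P = NP → PH = P` (via `NP = coNP → PH = NP`, Literature);
* `SoloBlind.pneNP_of_E_subset_PH : E ⊆ PH → PneNP`, and the weaker-hypothesis forms
  `pneNP_of_EXP_subset_PH`, `pneNP_of_E_subset_SigmaP`; the Meyer–Karp–Lipton win-win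
  `pneNP_of_EXP_subset_PPoly : (Meyer) → EXP ⊆ P/poly → PneNP`.

No new mathematics (Stockmeyer 1976; Hartmanis–Stearns 1965); the point is the typed dependency.
References: D. M. McKay, C. D. Murray, R. R. Williams, STOC 2019, §6 ("Sparse problems?");
L. Chen, C. Jin, R. R. Williams, *Hardness magnification for all sparse NP languages*, FOCS 2019,
Thm. 1.5, App. A–B; L. J. Stockmeyer, *The polynomial-time hierarchy*, TCS 3 (1976), Thm. 3.2.
-/

namespace Summit.PneNP.PneNP.Theorems

open Literature.Computability.Complexity

/-- **`E ⊄ P`**: the almost-everywhere-hard language of `exists_ae_hard_mem_E 1` lies in `E` but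
differs infinitely often from every language in `DTIME(2ⁿ) ⊇ P`. [Hartmanis–Stearns 1965;
Arora–Barak 2009, Thm. 3.1] -/
theorem SoloBlind.E_not_subset_P : ¬ E ⊆ Classes.P := by
  intro hEP
  obtain ⟨A, hAE, hA⟩ := exists_ae_hard_mem_E 1
  obtain ⟨n₀, hn₀⟩ := hA A (P_subset_DTIME_two_pow (hEP hAE))
  obtain ⟨x, -, hx⟩ := hn₀ n₀ le_rfl
  exact (iff_not_self hx).elim

/-- **`P = NP` collapses the polynomial hierarchy to `P`**: `P = NP` gives `NP = coNP`
(`co P = P`), hence `PH = NP = P`. [Stockmeyer 1976, Thm. 3.2; Arora–Barak 2009, Thm. 5.4] -/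
theorem SoloBlind.PH_eq_P_of_P_eq_NP (h : Classes.P = Nondeterministic.NP) : PH = Classes.P := by
  have hco : Nondeterministic.NP = coNP := by
    change Nondeterministic.NP = co Nondeterministic.NP
    rw [← h]
    exact co_P_holds.symm
  rw [PH_eq_NP_of_NP_eq_coNP hco, h]

/-- **No diagonal entry**: if `E ⊆ PH` then `P ≠ NP` — for `P = NP` would give
`E ⊆ PH = P`, contradicting the time hierarchy.  (In the document: a diagonal sparse language
has an `E`-hard succinct validity predicate, so it meets the `PH`-presentability hypothesis of
the general uniform magnification theorem only if `E ⊆ PH`, which already proves the summit.)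
[Stockmeyer 1976; Hartmanis–Stearns 1965] -/
theorem SoloBlind.pneNP_of_E_subset_PH (h : E ⊆ PH) : PneNP := by
  rw [SoloBlind.pneNP_iff_P_ne_NP]
  intro hPNP
  exact SoloBlind.E_not_subset_P (h.trans (SoloBlind.PH_eq_P_of_P_eq_NP hPNP).subset)

/-- The same with the (formally stronger) hypothesis `EXP ⊆ PH`. [Stockmeyer 1976] -/
theorem SoloBlind.pneNP_of_EXP_subset_PH (h : EXP ⊆ PH) : PneNP :=
  SoloBlind.pneNP_of_E_subset_PH (E_subset_EXP.trans h)

/-- The same at a fixed level: `E ⊆ Σₖᵖ → PneNP`. [Stockmeyer 1976] -/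
theorem SoloBlind.pneNP_of_E_subset_SigmaP {k : ℕ} (h : E ⊆ SigmaP k) : PneNP :=
  SoloBlind.pneNP_of_E_subset_PH (h.trans (SigmaP_subset_PH k))

/-- **Meyer–Karp–Lipton win-win**, summit form: under Meyer's theorem
(`EXP ⊆ P/poly → EXP = Σ₂ᵖ`, a named Literature fact), `EXP ⊆ P/poly → PneNP`; equivalently,
either `EXP ⊄ P/poly` or `P ≠ NP`. [Karp–Lipton 1980, Thm. 6.2 (attributed to A. Meyer);
Arora–Barak 2009, Thm. 6.20 and the remark after it] -/
theorem SoloBlind.pneNP_of_EXP_subset_PPoly (hM : EXP_eq_SigmaP_two_of_subset_PPoly)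
    (h : EXP ⊆ PPoly) : PneNP :=
  SoloBlind.pneNP_of_EXP_subset_PH (EXP_subset_PH_of_subset_PPoly hM h)

/-- Contrapositive reading used in the document: under the negated summit `P = NP`, no language
outside `P` — in particular no time-hierarchy language in `E ∖ P` — lies in `PH`.
[Stockmeyer 1976] -/
theorem SoloBlind.not_mem_PH_of_P_eq_NP (h : Classes.P = Nondeterministic.NP) {L : Language Bool}
    (hL : L ∉ Classes.P) : L ∉ PH := by
  rw [SoloBlind.PH_eq_P_of_P_eq_NP h]
  exact hL

/-- There is a language in `E ∖ P` (witness for the previous lemma). [Hartmanis–Stearns 1965] -/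
theorem SoloBlind.exists_mem_E_not_mem_P : ∃ L ∈ E, L ∉ Classes.P := by
  by_contra h
  exact SoloBlind.E_not_subset_P fun L hL => by_contra fun hLP => h ⟨L, hL, hLP⟩

end Summit.PneNP.PneNP.Theorems
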